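import Mathlib
import HarnessLib
import Literature.Analysis.FluidPDE.TypeIAncientMild
import Literature.Analysis.FluidPDE.OseenSlice
import Literature.Analysis.FluidPDE.UlocKernelEstimates
import Literature.Analysis.FluidPDE.LerayVolterraComparison
import Literature.Analysis.FluidPDE.OseenDuhamelPairCalculus
import Summits.NavierStokesRegularity.NavierStokesRegularity.Theorems.QuarterLogPincerTruncationEdgeDefs
import Summits.NavierStokesRegularity.NavierStokesRegularity.Theorems.QuarterLogPincerTypeIQuantSubcubicExpFrameTools
import Summits.NavierStokesRegularity.NavierStokesRegularity.Theorems.QuarterLogPincerQuietCoreDefs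
import Summits.NavierStokesRegularity.NavierStokesRegularity.Theorems.QuarterLogPincerQuietCoreRecessionLaw
import Summits.NavierStokesRegularity.NavierStokesRegularity.Theorems.QuarterLogPincerQuietCoreFarKick

/-!
# Route `QuarterLogPincer`, crux `TypeIQuantSubcubicExp` (stmt-NavierStokesRegularity-24077), line `quiet_core` —
# §1e preliminaries (PROVED in-file v1.5; ported VERBATIM): small tools of the receding-ball assembly

`recessPhi_nonneg`, `recessPhi_le`, `farKick_nonneg`, `intervalIntegrable_farKick`.
HONEST FRAME: estimates about HYPOTHETICAL Type-I ancient mild fields; nothing here bears on 24077, W7 or Navier–Stokes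
regularity (OPEN).  Port by the pub-ns-dss typer (g36), DIRECTOR-NS KEY-NS #181/#182; bodies VERBATIM from tree `Lines/quiet_core.lean`
v1.5 (sha12 d1a96bf31391, ns-idea-7 g10; critic of record idea-crit-4 g6); docstrings added where the line had none.
-/

noncomputable section

set_option linter.dupNamespace false

namespace Summit.NavierStokesRegularity.NavierStokesRegularity.Cruxes.TypeIQuantSubcubicExp.QuietCore

open MeasureTheory Set Function Metric Filter Topology
open scoped ENNReal NNReal
open Literature.Analysis Literature.Analysis.FluidPDE
open Summit.NavierStokesRegularity.NavierStokesRegularity.Cruxes.TypeIQuantSubcubicExp.TruncationEdge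

section Assembly
open Real


/-- `Φ ≥ 0` on `(0, b]`. -/
theorem recessPhi_nonneg {κ b c₁ u : ℝ} (hκ : 0 ≤ κ) (hb : 0 < b) (hc₁ : 0 ≤ c₁) (hu : 0 < u) (hub : u ≤ b) :
    0 ≤ recessPhi κ b c₁ u := by
  have hlog : 0 ≤ Real.log (b / u) := Real.log_nonneg (by rw [le_div_iff₀ hu, one_mul]; exact hub)
  unfold recessPhi
  have h1 : 0 ≤ b ^ (3 / 8 : ℝ) := Real.rpow_nonneg hb.le _
  have h2 : 0 ≤ u ^ (1 / 8 : ℝ) := Real.rpow_nonneg hu.le _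
  have h3 : 0 ≤ c₁ + 8 + Real.log (b / u) := by linarith
  positivity

/-- `Φ` is monotone on `(0, b]`. -/
theorem recessPhi_le {κ b c₁ a v : ℝ} (hκ : 0 < κ) (hb : 0 < b) (hc₁ : 0 < c₁)
    (ha : 0 < a) (hav : a ≤ v) (hvb : v ≤ b) :
    recessPhi κ b c₁ a ≤ recessPhi κ b c₁ v := by
  rcases eq_or_lt_of_le hav with h | h
  · rw [h]
  · exact (recessPhi_lt hκ hb hc₁ ha h hvb).le

/-- Nonnegativity of the far-kick integrand on `(a, b]`. -/
theorem farKick_nonneg {κ b c₁ a I u : ℝ} (hκ : 0 < κ) (hb : 0 < b) (hc₁ : 0 < c₁) (hI : 0 ≤ I) (ha : 0 < a)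
    (hau : a < u) (hub : u ≤ b) :
    0 ≤ u⁻¹ * min (I * (u - a) ^ (-(1 / 2 : ℝ))) (4 * π / (recessPhi κ b c₁ u - recessPhi κ b c₁ a)) := by
  have hu : 0 < u := ha.trans hau
  have hd : 0 < recessPhi κ b c₁ u - recessPhi κ b c₁ a := sub_pos.2 (recessPhi_lt hκ hb hc₁ ha hau hub)
  exact mul_nonneg (inv_nonneg.2 hu.le) (le_min (mul_nonneg hI (Real.rpow_nonneg (by linarith) _))
    (div_nonneg (by positivity) hd.le))

/-- Interval-integrability of the far-kick integrand on `[a, b]`. -/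
theorem intervalIntegrable_farKick {κ b c₁ a I : ℝ} (hκ : 0 < κ) (hI : 0 < I) (ha : 0 < a) (hab : a < b)
    (hc₁ : 2 ≤ c₁) :
    IntervalIntegrable (fun u : ℝ => u⁻¹ * min (I * (u - a) ^ (-(1 / 2 : ℝ)))
      (4 * π / (recessPhi κ b c₁ u - recessPhi κ b c₁ a))) volume a b := by
  have hb : 0 < b := ha.trans hab
  have hc₁pos : 0 < c₁ := by linarith
  set g : ℝ → ℝ := fun u => u⁻¹ * min (I * (u - a) ^ (-(1 / 2 : ℝ)))
      (4 * π / (recessPhi κ b c₁ u - recessPhi κ b c₁ a)) with hg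
  have hgc : ContinuousOn g (Ioc a b) := by rw [hg]; exact continuousOn_farKick hκ hb hc₁pos ha
  set a₂ : ℝ := min (2 * a) b with ha₂
  have ha₂a : a < a₂ := lt_min (by linarith) hab
  have ha₂b : a₂ ≤ b := min_le_right _ _
  have hsq_int : IntervalIntegrable (fun u : ℝ => a⁻¹ * (I * (u - a) ^ (-(1 / 2 : ℝ)))) volume a a₂ := by
    have h0 : IntervalIntegrable (fun x : ℝ => x ^ (-(1 / 2 : ℝ))) volume 0 (a₂ - a) :=
      intervalIntegral.intervalIntegrable_rpow' (by norm_num)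
    have h1 := ((h0.comp_sub_right a).const_mul I).const_mul a⁻¹
    simp only [zero_add, sub_add_cancel] at h1
    exact h1
  have hg_int1 : IntervalIntegrable g volume a a₂ := by
    refine hsq_int.mono_fun' ?_ ?_
    · refine (hgc.mono ?_).aestronglyMeasurable measurableSet_uIoc
      rw [uIoc_of_le ha₂a.le]; exact fun u hu => ⟨hu.1, hu.2.trans ha₂b⟩
    · rw [uIoc_of_le ha₂a.le]
      refine (ae_restrict_mem measurableSet_Ioc).mono fun u hu => ?_
      show ‖g u‖ ≤ a⁻¹ * (I * (u - a) ^ (-(1 / 2 : ℝ)))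
      have hub : u ≤ b := hu.2.trans ha₂b
      rw [Real.norm_of_nonneg (by rw [hg]; exact farKick_nonneg hκ hb hc₁pos hI.le ha hu.1 hub), hg]
      refine mul_le_mul (inv_anti₀ ha hu.1.le) (min_le_left _ _) ?_ (inv_nonneg.2 ha.le)
      have hd : 0 < recessPhi κ b c₁ u - recessPhi κ b c₁ a :=
        sub_pos.2 (recessPhi_lt hκ hb hc₁pos ha hu.1 hub)
      exact le_min (mul_nonneg hI.le (Real.rpow_nonneg (by linarith [hu.1]) _)) (div_nonneg (by positivity) hd.le)
  have hg_int2 : IntervalIntegrable g volume a₂ b := by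
    refine (hgc.mono ?_).intervalIntegrable
    rw [uIcc_of_le ha₂b]; exact fun u hu => ⟨ha₂a.trans_le hu.1, hu.2⟩
  exact hg_int1.trans hg_int2

end Assembly

end Summit.NavierStokesRegularity.NavierStokesRegularity.Cruxes.TypeIQuantSubcubicExp.QuietCore

end
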